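import Summits.FinalStateConjecture.FinalStateConjecture.Theorems.EIHFluxBalanceInertialRecessionStubChargeModelDecay
import Summits.FinalStateConjecture.FinalStateConjecture.Theorems.EIHFluxBalanceInertialRecessionFlatChart

/-!
# Route EIHFluxBalance — `InertialRecession`, line `sublinear-is-free-clean-window-charges`:
# the modulated background far from the holes (helpers for `stub_chargeModel`)

Helper file (`--supports stmt-FinalStateConjecture-10166`) for the crux
`Summit.FinalStateConjecture.FinalStateConjecture.Theses.EIHFluxBalance.InertialRecession`.

For the crux's modulated multi-Kerr–Schild reference field
`G(x) = η + Σᵢ (boostedKerrBilin (Λᵢ(x⁰)) (x⁰, ξᵢ(x⁰)) Mᵢ aᵢ x − η)` we prove: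

* `mem_domain_of_far` — a late point at lab distance `> √(rinᵢ² + aᵢ²)` from every centre lies in the
  chart domain `U` (the crux's clause `{τ₀ < x⁰, rinᵢ < rᵢ} ⊆ U` with "far in the lab ⇒ far in every
  painted frame", `sq_sub_sq_le_radius_poincareInv_sq`);
* `le_radius_poincareInv_of_far` — `R₀ ≤ rᵢ` at lab distance `≥ R₀ + |aᵢ|`;
* `norm_fderiv_background_spatial_le` — **the `O(M/d²)` bound on the SPATIAL first derivatives of the
  modulated background**: for spatial `w` (`w⁰ = 0`) and a point at lab distance `dᵢ ≥ R₀` from the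
  centres, `‖DG(y) w‖ ≤ (Σᵢ Cᵢ ‖Λᵢ(y⁰)⁻¹‖³ / dᵢ²) ‖w‖`. Spatial derivatives do not see the time
  dependence of the painted moduli (`KSDecay.fderiv_apply_eq_of_eqOn_slice`), so only the frozen
  fields enter (`KSDecay.norm_fderiv_boostedKerrBilin_le`) and NO bound on `Λ̇ᵢ` (the Kerr–Schild
  stabiliser twist) is needed; the lab-time derivative is the business of quasi-stationarity.
-/

set_option linter.dupNamespace false
-- instance search on the nested operator spaces needs a deeper pending depth (as in `CoordCurvature.lean`)
set_option maxSynthPendingDepth 3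

noncomputable section

open scoped ContDiff Topology BigOperators
open Filter Set Function TopologicalSpace Literature.Geometry.Lorentzian

namespace Summit.FinalStateConjecture.FinalStateConjecture.Theorems

namespace KSDecay

/-! ### Far lab points: in the domain, far in every painted frame -/

/-- **Far in the lab ⇒ beyond radius `R₀` in the painted frame**: if `(R₀ + |a|)² ≤ ‖y~ − ξ‖²`-type
separation holds, precisely `R₀ + |a| ≤ ‖y~ − ξ‖` with `0 ≤ R₀`, then `R₀ ≤ r_a(Λ⁻¹(y − (y⁰, ξ)))` for
every `Λ ∈ O(1,3)`. [folklore] -/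
theorem le_radius_poincareInv_of_far (Λ : lorentzGroup) (a : ℝ) (ξ : E3) {y : E4} {R₀ : ℝ} (hR₀ : 0 ≤ R₀)
    (hfar : R₀ + |a| ≤ ‖E4.spatial y - ξ‖) :
    R₀ ≤ Kerr.radius a (poincareInv Λ (E4.ofTimeSpace (y 0) ξ) y) := by
  have h := sq_sub_sq_le_radius_poincareInv_sq Λ a (y 0) ξ (x := y) rfl
  have hr := Kerr.radius_nonneg a (poincareInv Λ (E4.ofTimeSpace (y 0) ξ) y)
  refine (sq_le_sq₀ hR₀ hr).1 ?_
  have h1 : (R₀ + |a|) ^ 2 ≤ ‖E4.spatial y - ξ‖ ^ 2 := pow_le_pow_left₀ (by positivity) hfar 2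
  have h2 : R₀ ^ 2 + a ^ 2 ≤ (R₀ + |a|) ^ 2 := by
    rw [← sq_abs a]
    nlinarith [abs_nonneg a]
  linarith

/-- **Far late lab points lie in the chart domain**: under the crux's domain clause
`{τ₀ < x⁰, ∀ i, rinᵢ < rᵢ(x)} ⊆ U`, a point with `τ₀ < y⁰` at lab distance `> rinᵢ + |aᵢ|` from every
centre `ξᵢ(y⁰)` lies in `U`. [folklore] -/
theorem mem_domain_of_far {N : ℕ} {U : Opens E4} {τ₀ : ℝ} {a rin : Fin N → ℝ}
    {Λ : Fin N → ℝ → lorentzGroup} {ξ : Fin N → ℝ → E3}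
    (hU : {x : E4 | τ₀ < x 0 ∧ ∀ i, rin i < Kerr.radius (a i)
      (poincareInv (Λ i (x 0)) (E4.ofTimeSpace (x 0) (ξ i (x 0))) x)} ⊆ (U : Set E4))
    (hrin : ∀ i, 0 ≤ rin i) {y : E4} (hy : τ₀ < y 0)
    (hfar : ∀ i, rin i + |a i| < ‖E4.spatial y - ξ i (y 0)‖) : y ∈ (U : Set E4) := by
  refine hU ⟨hy, fun i ↦ ?_⟩
  obtain ⟨R₀, hR₀, hR⟩ : ∃ R₀, rin i < R₀ ∧ R₀ + |a i| ≤ ‖E4.spatial y - ξ i (y 0)‖ :=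
    ⟨‖E4.spatial y - ξ i (y 0)‖ - |a i|, by linarith [hfar i], by linarith⟩
  exact hR₀.trans_le (le_radius_poincareInv_of_far (Λ i (y 0)) (a i) (ξ i (y 0))
    ((hrin i).trans hR₀.le) hR)

/-- The lab separation is a lower bound for the rest-frame spatial separation:
`‖y~ − ξ‖ ≤ ‖(Λ⁻¹(y − (y⁰, ξ)))~‖` (boosts only stretch spatial vectors). [folklore] -/
theorem norm_sub_le_spatialNorm_poincareInv (Λ : lorentzGroup) (ξ : E3) (y : E4) :
    ‖E4.spatial y - ξ‖ ≤ E4.spatialNorm (poincareInv Λ (E4.ofTimeSpace (y 0) ξ) y) := by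
  obtain ⟨h0, hn⟩ := sub_ofTimeSpace_apply_zero (rfl : y 0 = y 0) ξ
  have h1 := norm_le_spatialNorm_lorentz_apply Λ⁻¹ h0
  rw [coe_lorentz_inv, hn] at h1
  exact h1

/-! ### Spatial first derivatives of the modulated background -/

-- the algebraic and the operator-norm instance paths on `E4 →L[ℝ] E4 →L[ℝ] ℝ` unify slowly
set_option synthInstance.maxHeartbeats 400000 in
set_option maxHeartbeats 1600000 in
/-- **`O(M/d²)` decay of the spatial first derivatives of the modulated background.** For masses and
spins `M, a` there are `C ≥ 0` and `R₀ > 0` such that for all `C¹` motions (frame paths `s ↦ Λᵢ(s)⁻¹`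
as operators, centres `ξᵢ`), every point `y` at lab distance `≥ R₀` from every centre `ξᵢ(y⁰)` and
every SPATIAL direction `w` (`w⁰ = 0`):
`‖D[x ↦ η + Σᵢ (boostedKerrBilin (Λᵢ(x⁰)) (x⁰, ξᵢ(x⁰)) Mᵢ aᵢ x − η)](y) w‖
  ≤ (Σᵢ C ‖Λᵢ(y⁰)⁻¹‖³ / ‖y~ − ξᵢ(y⁰)‖²) ‖w‖`.
The derivative in a spatial direction equals that of the background FROZEN at lab time `y⁰`
(`fderiv_apply_eq_of_eqOn_slice`), whose summands obey `norm_fderiv_boostedKerrBilin_le`; no bound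
on the rates of the moduli is used. Kerr–Schild 1965, §3 (asymptotics of the Kerr–Schild form).
[cite: KerrSchild1965, §3] -/
theorem norm_fderiv_background_spatial_le {N : ℕ} (M a : Fin N → ℝ) :
    ∃ C R₀ : ℝ, 0 ≤ C ∧ 0 < R₀ ∧ ∀ (Λ : Fin N → ℝ → lorentzGroup) (ξ : Fin N → ℝ → E3),
      (∀ i, ContDiff ℝ 1 (fun s ↦ (((Λ i s : E4 ≃L[ℝ] E4).symm : E4 →L[ℝ] E4)))) →
      (∀ i, ContDiff ℝ 1 (ξ i)) →
      ∀ (y w : E4), w 0 = 0 → (∀ i, R₀ ≤ ‖E4.spatial y - ξ i (y 0)‖) →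
        ‖fderiv ℝ (fun x : E4 ↦ Minkowski.bilin + ∑ i, (boostedKerrBilin (Λ i (x 0))
            (E4.ofTimeSpace (x 0) (ξ i (x 0))) (M i) (a i) x - Minkowski.bilin)) y w‖ ≤
          (∑ i, C * ‖(((Λ i (y 0) : E4 ≃L[ℝ] E4).symm : E4 →L[ℝ] E4))‖ ^ 3 /
            ‖E4.spatial y - ξ i (y 0)‖ ^ 2) * ‖w‖ := by
  -- per-hole constants from the frozen decay, then uniformise
  choose C R hC hR hdec using fun i ↦ norm_fderiv_boostedKerrBilin_le (M i) (a i)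
  have hRa : ∀ j, 0 ≤ R j + |a j| := fun j ↦ add_nonneg (hR j).le (abs_nonneg _)
  have hsum : 0 ≤ ∑ j, (R j + |a j|) := Finset.sum_nonneg fun j _ ↦ hRa j
  refine ⟨∑ i, C i, 1 + ∑ i, (R i + |a i|), Finset.sum_nonneg fun i _ ↦ hC i,
    by linarith, ?_⟩
  intro Λ ξ hΛ hξ y w hw hfar
  have hCi : ∀ i, C i ≤ ∑ j, C j := fun i ↦
    Finset.single_le_sum (f := C) (fun j _ ↦ hC j) (Finset.mem_univ i)
  have hRi : ∀ i, R i + |a i| ≤ 1 + ∑ j, (R j + |a j|) := fun i ↦ by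
    have := Finset.single_le_sum (f := fun j ↦ R j + |a j|) (fun j _ ↦ hRa j) (Finset.mem_univ i)
    linarith
  -- at `y`: beyond `R i` in every painted frame, rest-frame separation ≥ lab separation > 0
  have hrad : ∀ i, R i ≤ Kerr.radius (a i)
      (poincareInv (Λ i (y 0)) (E4.ofTimeSpace (y 0) (ξ i (y 0))) y) := fun i ↦
    le_radius_poincareInv_of_far (Λ i (y 0)) (a i) (ξ i (y 0)) (hR i).le ((hRi i).trans (hfar i))
  have hdpos : ∀ i, 0 < ‖E4.spatial y - ξ i (y 0)‖ := fun i ↦ by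
    have := hfar i
    linarith
  -- the frozen background at lab time `y⁰` and its derivative
  set t := y 0 with ht
  have hfro : ∀ i, DifferentiableAt ℝ (boostedKerrBilin (Λ i t) (E4.ofTimeSpace t (ξ i t)) (M i) (a i)) y ∧
      ‖fderiv ℝ (boostedKerrBilin (Λ i t) (E4.ofTimeSpace t (ξ i t)) (M i) (a i)) y‖ ≤
        C i * ‖(((Λ i t : E4 ≃L[ℝ] E4).symm : E4 →L[ℝ] E4))‖ ^ 3 /
          E4.spatialNorm (poincareInv (Λ i t) (E4.ofTimeSpace t (ξ i t)) y) ^ 2 :=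
    fun i ↦ hdec i (Λ i t) (E4.ofTimeSpace t (ξ i t)) y (hrad i)
  have hGt : HasFDerivAt (fun x : E4 ↦ Minkowski.bilin + ∑ i, (boostedKerrBilin (Λ i t)
      (E4.ofTimeSpace t (ξ i t)) (M i) (a i) x - Minkowski.bilin))
      (∑ i, fderiv ℝ (boostedKerrBilin (Λ i t) (E4.ofTimeSpace t (ξ i t)) (M i) (a i)) y) y := by
    have hs := HasFDerivAt.sum (u := Finset.univ)
      (A := fun i x ↦ boostedKerrBilin (Λ i t) (E4.ofTimeSpace t (ξ i t)) (M i) (a i) x - Minkowski.bilin)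
      (A' := fun i ↦ fderiv ℝ (boostedKerrBilin (Λ i t) (E4.ofTimeSpace t (ξ i t)) (M i) (a i)) y)
      (x := y) fun i _ ↦ ((hfro i).1.hasFDerivAt).sub_const Minkowski.bilin
    have := hs.const_add Minkowski.bilin
    simpa only [Finset.sum_apply] using this
  -- the modulated background is differentiable at `y` and agrees with the frozen one on the slice
  have hradΘ : ∀ i, 0 < Kerr.radius (a i) ((((Λ i (y 0) : E4 ≃L[ℝ] E4).symm : E4 →L[ℝ] E4))
      (y - E4.ofTimeSpace (y 0) (ξ i (y 0)))) := fun i ↦ (hR i).trans_le (hrad i)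
  have hGd : DifferentiableAt ℝ (fun x : E4 ↦ Minkowski.bilin + ∑ i, (boostedKerrBilin (Λ i (x 0))
      (E4.ofTimeSpace (x 0) (ξ i (x 0))) (M i) (a i) x - Minkowski.bilin)) y := by
    refine (differentiableAt_const _).add ?_
    have : (fun x : E4 ↦ ∑ i, (boostedKerrBilin (Λ i (x 0)) (E4.ofTimeSpace (x 0) (ξ i (x 0)))
        (M i) (a i) x - Minkowski.bilin)) = ∑ i, fun x : E4 ↦ boostedKerrBilin (Λ i (x 0))
          (E4.ofTimeSpace (x 0) (ξ i (x 0))) (M i) (a i) x - Minkowski.bilin := by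
      funext x
      simp only [Finset.sum_apply]
    rw [this]
    exact DifferentiableAt.sum fun i _ ↦
      ((contDiffAt_ansatzSummand (M := M i) (hΛ i) (hξ i) (hradΘ i)).differentiableAt one_ne_zero)
  have hslice : ∀ z : E4, z 0 = y 0 →
      (Minkowski.bilin + ∑ i, (boostedKerrBilin (Λ i (z 0)) (E4.ofTimeSpace (z 0) (ξ i (z 0)))
        (M i) (a i) z - Minkowski.bilin)) =
      (Minkowski.bilin + ∑ i, (boostedKerrBilin (Λ i t) (E4.ofTimeSpace t (ξ i t)) (M i) (a i) z -
        Minkowski.bilin)) := by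
    intro z hz
    rw [hz]
  have heq := fderiv_apply_eq_of_eqOn_slice hGd hGt.differentiableAt hslice hw
  rw [heq, hGt.fderiv]
  -- sum the frozen bounds
  rw [FunLike.coe_sum, Finset.sum_apply, Finset.sum_mul]
  refine (norm_sum_le _ _).trans (Finset.sum_le_sum fun i _ ↦ ?_)
  obtain ⟨_, hb⟩ := hfro i
  have hsp : ‖E4.spatial y - ξ i t‖ ≤
      E4.spatialNorm (poincareInv (Λ i t) (E4.ofTimeSpace t (ξ i t)) y) :=
    norm_sub_le_spatialNorm_poincareInv (Λ i t) (ξ i t) y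
  have hd0 : 0 < ‖E4.spatial y - ξ i t‖ := hdpos i
  calc ‖(fderiv ℝ (boostedKerrBilin (Λ i t) (E4.ofTimeSpace t (ξ i t)) (M i) (a i)) y) w‖
      ≤ ‖fderiv ℝ (boostedKerrBilin (Λ i t) (E4.ofTimeSpace t (ξ i t)) (M i) (a i)) y‖ * ‖w‖ :=
        ContinuousLinearMap.le_opNorm _ _
    _ ≤ (C i * ‖(((Λ i t : E4 ≃L[ℝ] E4).symm : E4 →L[ℝ] E4))‖ ^ 3 /
          E4.spatialNorm (poincareInv (Λ i t) (E4.ofTimeSpace t (ξ i t)) y) ^ 2) * ‖w‖ :=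
        mul_le_mul_of_nonneg_right hb (norm_nonneg _)
    _ ≤ (C i * ‖(((Λ i t : E4 ≃L[ℝ] E4).symm : E4 →L[ℝ] E4))‖ ^ 3 /
          ‖E4.spatial y - ξ i t‖ ^ 2) * ‖w‖ := by
        refine mul_le_mul_of_nonneg_right ?_ (norm_nonneg _)
        exact div_le_div_of_nonneg_left (mul_nonneg (hC i) (by positivity)) (by positivity)
          (pow_le_pow_left₀ hd0.le hsp 2)
    _ ≤ ((∑ j, C j) * ‖(((Λ i t : E4 ≃L[ℝ] E4).symm : E4 →L[ℝ] E4))‖ ^ 3 /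
          ‖E4.spatial y - ξ i t‖ ^ 2) * ‖w‖ := by
        refine mul_le_mul_of_nonneg_right ?_ (norm_nonneg _)
        refine div_le_div_of_nonneg_right ?_ (by positivity)
        exact mul_le_mul_of_nonneg_right (hCi i) (by positivity)

end KSDecay

-- the algebraic and the operator-norm instance paths on `E4 →L[ℝ] E4 →L[ℝ] ℝ` unify slowly
set_option synthInstance.maxHeartbeats 400000 in
/-- Registered sub-goal form (stub `norm_fderiv_modulatedBackground_spatial_le` of the crux item) of
`KSDecay.norm_fderiv_background_spatial_le`: `O(M/d²)` decay of the spatial first derivatives of the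
crux's modulated multi-Kerr–Schild background, with no bound on the rates of the moduli.
[cite: KerrSchild1965, §3] -/
theorem norm_fderiv_modulatedBackground_spatial_le : open Literature.Geometry.Lorentzian in ∀ {N : ℕ} (M a : Fin N → ℝ), ∃ C R₀ : ℝ, 0 ≤ C ∧ 0 < R₀ ∧ ∀ (Λ : Fin N → ℝ → lorentzGroup) (ξ : Fin N → ℝ → E3), (∀ i, ContDiff ℝ 1 (fun s ↦ (((Λ i s : E4 ≃L[ℝ] E4).symm : E4 →L[ℝ] E4)))) → (∀ i, ContDiff ℝ 1 (ξ i)) → ∀ (y w : E4), w 0 = 0 → (∀ i, R₀ ≤ ‖E4.spatial y - ξ i (y 0)‖) → ‖fderiv ℝ (fun x : E4 ↦ Minkowski.bilin + ∑ i, (boostedKerrBilin (Λ i (x 0)) (E4.ofTimeSpace (x 0) (ξ i (x 0))) (M i) (a i) x - Minkowski.bilin)) y w‖ ≤ (∑ i, C * ‖(((Λ i (y 0) : E4 ≃L[ℝ] E4).symm : E4 →L[ℝ] E4))‖ ^ 3 / ‖E4.spatial y - ξ i (y 0)‖ ^ 2) * ‖w‖ :=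
  fun M a ↦ KSDecay.norm_fderiv_background_spatial_le M a

end Summit.FinalStateConjecture.FinalStateConjecture.Theorems

end
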